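import Mathlib.LinearAlgebra.FiniteDimensional.Lemmas
import Mathlib.LinearAlgebra.Dimension.Constructions
import Mathlib.Data.Sym.Card
import Mathlib.Data.Finsupp.Multiset
import Literature.Computability.AlgebraicComplexity.Apolarity
import Literature.Computability.AlgebraicComplexity.ApolarityAction
import Literature.Barriers.ValiantsHypothesis.PartialDerivativesDetPerm
import Literature.Barriers.ValiantsHypothesis.ShiftedPartialsMonotone

/-!
# Border apolarity, crux `FixedWitnessObstructionQP` — the Hilbert function of a translate of `det_m^⊥`

Route `ValiantsHypothesis/BorderApolarity`, crux item `stmt-ValiantsHypothesis-5778`, line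
`cone-purity-squeeze`, stub `stub_annSubmodule` (the content of clause W1 used by normal form N1 of
the skeleton): for `P ∈ GL_{m²} · det_m` and every `k`, the degree-`k` annihilator
`Ann_k(P) = {D homogeneous of degree k | D ⌟ P = 0}` is a linear subspace of the degree-`k` forms of
dimension `C(m² + k - 1, k) - C(m, k)²`.

Proof.  The flattening `Φ : D ↦ D ⌟ P` is linear in `D` (`apolarAction_add_left`,
`apolarAction_smul_left`); `Ann_k(P)` is the kernel of its restriction to `Hom_k`, so by
rank–nullity `dim Ann_k(P) = dim Hom_k - dim Φ(Hom_k)`.  Here `dim Hom_k = #Sym(σ, k) =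
C(|σ| + k - 1, k)` (stars and bars), and `Φ(Hom_k)` is the span of the `k`-th order iterated
partial derivatives of `P` (`Hom_k` is spanned by the monomials `x^d`, `|d| = k`, each a product of
`k` variables, and `(X_{i₁} ⋯ X_{i_k}) ⌟ f = ∂_{i₁} ⋯ ∂_{i_k} f` by the derivative rule), whose
dimension is the tree's flattening rank `shiftedPartialsRank ℂ k 0 P`
(`Literature.Barriers.ValiantsHypothesis.shiftedPartialsRank_zero_eq`).  That rank is
`GL`-invariant (`shiftedPartialsRank_linSubst_le_of_mul_eq_one` applied to `g` and `g⁻¹`) and equals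
`C(m, k)²` on `det_m` (`flatteningRank_detPoly`, Landsberg 2017 (7.6.10): the `k`-th partials of
`det_m` span the `(m-k)`-minors).
-/

open MvPolynomial Filter
open scoped BigOperators Matrix
open Literature.Computability.AlgebraicComplexity

namespace Summit.ValiantsHypothesis.ValiantsHypothesis.Theorems.BorderApolarityFixedWitnessObstructionQP

open Literature.Barriers.ValiantsHypothesis

section Bridge

variable {σ : Type*} {R : Type*} [CommRing R]

/-- **Bridge to the tree's iterated partials**: `(X_{i₁} ⋯ X_{i_k}) ⌟ f = ∂_{i₁} ⋯ ∂_{i_k} f`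
(the derivative rule `Xᵢ ⌟ g = ∂ᵢ g` and multiplicativity of the apolarity action). [folklore] -/
theorem apolarAction_prod_X (l : List σ) (f : MvPolynomial σ R) :
    apolarAction (l.map X).prod f = iterPDeriv l f := by
  induction l with
  | nil => rw [List.map_nil, List.prod_nil, ← C_1, apolarAction_C, one_smul, iterPDeriv_nil]
  | cons i l ih =>
    rw [List.map_cons, List.prod_cons, apolarAction_X_mul, ih, apolarAction_X, iterPDeriv_cons]

/-- Every monic monomial `x^d` is a product of `|d|` variables. [folklore] -/
theorem exists_prod_X_eq_monomial (d : σ →₀ ℕ) :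
    ∃ l : List σ, l.length = d.degree ∧ (l.map X).prod = monomial d (1 : R) := by
  induction d using Finsupp.induction with
  | zero => exact ⟨[], by simp, by simp⟩
  | single_add a b f _ _ ih =>
    obtain ⟨l, hl, hprod⟩ := ih
    refine ⟨List.replicate b a ++ l, ?_, ?_⟩
    · rw [List.length_append, List.length_replicate, hl, map_add, Finsupp.degree_single]
    · rw [List.map_append, List.prod_append, List.map_replicate, List.prod_replicate, hprod,
        X_pow_eq_monomial, monomial_mul, one_mul]

/-- Every product of variables is a monic monomial of degree the number of factors. [folklore] -/
theorem exists_monomial_eq_prod_X (l : List σ) :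
    ∃ d : σ →₀ ℕ, d.degree = l.length ∧ monomial d (1 : R) = (l.map X).prod := by
  induction l with
  | nil => exact ⟨0, by simp, by simp⟩
  | cons i l ih =>
    obtain ⟨d, hd, hprod⟩ := ih
    refine ⟨Finsupp.single i 1 + d, ?_, ?_⟩
    · rw [map_add, Finsupp.degree_single, hd, List.length_cons, add_comm]
    · rw [List.map_cons, List.prod_cons, ← hprod, X, monomial_mul, one_mul]

end Bridge

section Flattening

variable {σ : Type*} {K : Type*} [Field K]

/-- **The image of the flattening.**  For a linear map `Φ` agreeing with `D ↦ D ⌟ f`, the image of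
the degree-`k` forms is the span of the `k`-th order iterated partial derivatives of `f`
(`derivSet k f`): `Hom_k` is spanned by the monomials of degree `k`, each a product of `k`
variables, and `(X_{i₁} ⋯ X_{i_k}) ⌟ f = ∂_{i₁} ⋯ ∂_{i_k} f`. [folklore] -/
theorem map_homogeneousSubmodule_eq_span_derivSet (k : ℕ) (f : MvPolynomial σ K)
    (Φ : MvPolynomial σ K →ₗ[K] MvPolynomial σ K) (hΦ : ∀ D, Φ D = apolarAction D f) :
    (homogeneousSubmodule σ K k).map Φ = Submodule.span K (derivSet k f) := by
  apply le_antisymm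
  · rw [Submodule.map_le_iff_le_comap]
    intro D hD
    have key : Submodule.span K {q | ∃ β : σ →₀ ℕ, β.degree = k ∧ q = monomial β (1 : K)} ≤
        (Submodule.span K (derivSet k f)).comap Φ := by
      rw [Submodule.span_le]
      rintro _ ⟨β, hβ, rfl⟩
      simp only [SetLike.mem_coe, Submodule.mem_comap]
      obtain ⟨l, hl, hprod⟩ := exists_prod_X_eq_monomial (R := K) β
      rw [hΦ, ← hprod, apolarAction_prod_X]
      exact Submodule.subset_span ⟨l, hl.trans hβ, rfl⟩
    exact key (mem_span_monomial_of_isHomogeneous ((mem_homogeneousSubmodule k D).1 hD))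
  · rw [Submodule.span_le]
    rintro _ ⟨l, hl, rfl⟩
    obtain ⟨d, hd, hprod⟩ := exists_monomial_eq_prod_X (R := K) l
    refine ⟨monomial d 1, ?_, ?_⟩
    · exact (mem_homogeneousSubmodule k _).2 (isHomogeneous_monomial _ (hd.trans hl))
    · rw [hΦ, hprod, apolarAction_prod_X]

/-- **Stars and bars**: `dim_K K[x_σ]_k = C(|σ| + k - 1, k)` — the monomials of degree `k` form a
basis (`MvPolynomial.homogeneousSubmodule_eq_finsupp_supported`) and correspond to `Sym σ k`
(`Sym.equivNatSum`, `Sym.card_sym_eq_choose`). [folklore] -/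
theorem finrank_homogeneousSubmodule_eq_choose_card [Fintype σ] (k : ℕ) :
    Module.finrank K (homogeneousSubmodule σ K k) = (Fintype.card σ + k - 1).choose k := by
  classical
  have e1 : (homogeneousSubmodule σ K k : Submodule K (MvPolynomial σ K)) =
      AddMonoidAlgebra.supported K K {v : σ →₀ ℕ | v.degree = k} :=
    homogeneousSubmodule_eq_finsupp_supported σ K k
  let e : homogeneousSubmodule σ K k ≃ₗ[K] ({v : σ →₀ ℕ // v.degree = k} →₀ K) :=
    (LinearEquiv.ofEq _ _ e1).trans (AddMonoidAlgebra.supportedEquivFinsupp _)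
  -- monomials of degree `k` ↔ multisets of size `k`
  let g : {v : σ →₀ ℕ // v.degree = k} ≃ Sym σ k :=
    (Equiv.subtypeEquivRight fun v => by rw [Finsupp.degree_apply]; exact Iff.rfl).trans
      (Sym.equivNatSum σ k).symm
  letI : Fintype {v : σ →₀ ℕ // v.degree = k} := Fintype.ofEquiv _ g.symm
  rw [e.finrank_eq, Module.finrank_finsupp_self, ← Nat.card_eq_fintype_card, Nat.card_congr g,
    Nat.card_eq_fintype_card, Sym.card_sym_eq_choose]

/-- **The annihilator as the kernel of the flattening.**  For every polynomial `f` in finitely many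
variables over a field, `Ann_k(f)` is (the carrier of) a linear subspace `A` of the degree-`k`
forms with `dim A + rank f_{k,·} = dim Hom_k = C(|σ| + k - 1, k)` (rank–nullity for
`D ↦ D ⌟ f` on `Hom_k`, whose image is the span of the `k`-th partials, of dimension
`shiftedPartialsRank K k 0 f`).  Landsberg 2017 §10.1.2 (`Ann_k = ker f_{k,d-k}`). [folklore] -/
theorem exists_annSubmodule [Fintype σ] (k : ℕ) (f : MvPolynomial σ K) :
    ∃ A : Submodule K (MvPolynomial σ K),
      (A : Set (MvPolynomial σ K)) = annihilatorOfDegree f k ∧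
      A ≤ homogeneousSubmodule σ K k ∧
      Module.finrank K A + shiftedPartialsRank K k 0 f = (Fintype.card σ + k - 1).choose k := by
  classical
  -- the flattening `D ↦ D ⌟ f` as a linear map
  let Φ : MvPolynomial σ K →ₗ[K] MvPolynomial σ K :=
    { toFun := fun D => apolarAction D f
      map_add' := fun D E => apolarAction_add_left D E f
      map_smul' := fun c D => apolarAction_smul_left c D f }
  have hΦ : ∀ D, Φ D = apolarAction D f := fun D => rfl
  haveI : Module.Finite K (homogeneousSubmodule σ K k) :=
    Module.Finite.iff_fg.2 (homogeneousSubmodule_fg σ K k)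
  refine ⟨(LinearMap.ker (Φ.domRestrict (homogeneousSubmodule σ K k))).map
      (homogeneousSubmodule σ K k).subtype, ?_, Submodule.map_subtype_le _ _, ?_⟩
  · ext D
    simp only [SetLike.mem_coe, Submodule.mem_map, LinearMap.mem_ker, LinearMap.domRestrict_apply,
      Submodule.coe_subtype, mem_annihilatorOfDegree_iff, hΦ]
    constructor
    · rintro ⟨v, hv, rfl⟩
      exact ⟨(mem_homogeneousSubmodule k _).1 v.2, hv⟩
    · rintro ⟨hhom, hann⟩
      exact ⟨⟨D, (mem_homogeneousSubmodule k D).2 hhom⟩, hann, rfl⟩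
  · rw [Submodule.finrank_map_subtype_eq, shiftedPartialsRank_zero_eq,
      ← map_homogeneousSubmodule_eq_span_derivSet k f Φ hΦ, ← LinearMap.range_domRestrict,
      add_comm, LinearMap.finrank_range_add_finrank_ker, finrank_homogeneousSubmodule_eq_choose_card]

/-- **`GL`-invariance of the flattening ranks**: `rank (g · p)_{(k)[τ]} = rank p_{(k)[τ]}` for
invertible `g` (monotonicity under `g` and under `g⁻¹`).  ELSW 2018 §1.1. [folklore] -/
theorem shiftedPartialsRank_linSubst_generalLinearGroup [Fintype σ] [DecidableEq σ]
    (g : Matrix.GeneralLinearGroup σ K) (k τ : ℕ) (p : MvPolynomial σ K) :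
    shiftedPartialsRank K k τ (linSubst σ K (g : Matrix σ σ K) p) = shiftedPartialsRank K k τ p := by
  apply le_antisymm
  · exact shiftedPartialsRank_linSubst_le_of_mul_eq_one (Units.mul_inv g) k τ p
  · have h : p = linSubst σ K ((g⁻¹ : Matrix.GeneralLinearGroup σ K) : Matrix σ σ K)
        (linSubst σ K (g : Matrix σ σ K) p) := by
      rw [← AlgHom.comp_apply, ← linSubst_mul, Units.inv_mul, linSubst_one, AlgHom.id_apply]
    conv_lhs => rw [h]
    exact shiftedPartialsRank_linSubst_le_of_mul_eq_one (Units.inv_mul g) k τ _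

end Flattening

/-- **The Hilbert function of a translate of `det_m^⊥` (W1's content).**  For `P ∈ GL_{m²} · det_m`
and every `k`, the degree-`k` annihilator `Ann_k(P) = {D homogeneous of degree k | D ⌟ P = 0}` is
a linear subspace of the degree-`k` forms of dimension `C(m² + k - 1, k) - C(m, k)²`: the
flattening `D ↦ D ⌟ P` on `Hom_k` has kernel `Ann_k(P)` and image the span of the `k`-th order
partials of `P`, of dimension `C(m, k)²` (`GL`-invariance of the flattening rank and
`flatteningRank_detPoly`, Landsberg 2017 (7.6.10)), while `dim Hom_k = C(m² + k - 1, k)`.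
[folklore] -/
theorem stub_annSubmodule (m k : ℕ) (P : MvPolynomial (Fin m × Fin m) ℂ)
    (hP : P ∈ glOrbit (Fin m × Fin m) ℂ (detPoly (Fin m) ℂ)) :
    ∃ A : Submodule ℂ (MvPolynomial (Fin m × Fin m) ℂ),
      (A : Set (MvPolynomial (Fin m × Fin m) ℂ)) = annihilatorOfDegree P k ∧
      A ≤ MvPolynomial.homogeneousSubmodule (Fin m × Fin m) ℂ k ∧
      Module.finrank ℂ A = Nat.choose (m * m + k - 1) k - (Nat.choose m k) ^ 2 := by
  obtain ⟨A, hA, hle, hdim⟩ := exists_annSubmodule k P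
  refine ⟨A, hA, hle, ?_⟩
  have hrank : shiftedPartialsRank ℂ k 0 P = (m.choose k) ^ 2 := by
    obtain ⟨g, hg⟩ := hP
    simp only [linSubstRep_apply] at hg
    rw [← hg, shiftedPartialsRank_linSubst_generalLinearGroup, flatteningRank_detPoly]
  rw [Fintype.card_prod, Fintype.card_fin, hrank] at hdim
  exact Nat.eq_sub_of_add_eq hdim

end Summit.ValiantsHypothesis.ValiantsHypothesis.Theorems.BorderApolarityFixedWitnessObstructionQP
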